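import Summits.HubbardSuperconductivity.HubbardSuperconductivity.Theses.AposterioriCapRg

/-!
# Restatement candidates for crux [3] `SeededBrokenRegimeBoseFermiPinned` (stmt-HubbardSuperconductivity-14047) — option (α)

Lead c1 (`prover-line-stmt-HubbardSuperconductivity-14047-c1-0`), 2026-08-16.  EVIDENCE FOR THE PLANNER, not a proposal:
the typed shape of restatement option (α) of `LEAD_VERDICT.md` (literal thresholds shared by [3] and R, drefute's scale cap
inside `∃ D`), with the glue re-proved, so that a route-repair pass only has to choose the two numerals.

* `SeededBrokenRegimeBoseFermiPinnedAt kStar₀ etaStar₀` — [3] at FIXED thresholds: the `∀ kStar etaStar` prefix is gone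
  (it carried the `∀ etaStar` floor of the report D1″: Disproof.lean §9, FLOOR_c2.md, and the kernel-checked N5–N8 of
  `Theorems/AposterioriCapRgSeededBrokenRegimeBoseFermiPinnedAnomalousKernel{Floor,Certified}.lean`), and the datum is
  scale-capped `D.scale ≤ Λ·e⁻⁸/30` (drefute W1: uncapped data at scales ≥ Λ_c have `m₀(h) → 0`).
* `AposterioriOrderCriterionRAt kStar₀ etaStar₀` — R at the SAME fixed thresholds (R's own `∃ kStar etaStar` prefix becomes
  the route-level choice of the two literals).
* `fixedPoint_of_at` — the certified chain still closes by pure logic: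
  `CapRgSymmetricCertificatePinned → [3]At k η → RAt k η → FixedPointDWaveOrder` for ANY `k ≥ 0`, `η`; so the route's
  `closes` survives the restatement verbatim up to the two item signatures.
* Constraints on the numerals (not formal): `etaStar₀` above the D1″ floor of the kept sector (cdisprove: `c_W ≈ 0.027/v_F²`,
  ≈ 2·10⁻² safe in the physical frame once the mixing block is added), `kStar₀` whatever R's Gaussian-phase core needs.

Everything elaborates against the current tree (rc 0, 0 sorry); nothing here is asserted about the model.
-/

set_option linter.dupNamespace false

namespace Summit.HubbardSuperconductivity.HubbardSuperconductivity.Cruxes.SeededBrokenRegimeBoseFermiPinned.Restatement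

open Summit.HubbardSuperconductivity.HubbardSuperconductivity.Theses.AposterioriCapRg
open Literature.MathematicalPhysics.QuantumLattice

/-- **[3] at fixed thresholds, scale-capped (restatement option (α))**: there is a tolerance `Θ` such that at every
certified point of the box (density clause byte-identical to `FixedPointDWaveOrder`), for every certificate
`symmetricRegimeCertificateT U μ capRgCornerDataT Θ K Λ L₀`, there are `h₀ > 0` and ONE datum `D` with
`D.scale ≤ Λ·e⁻⁸/30`, `D.MeetsThresholds kStar₀ etaStar₀`, `0 < N_p`, `0 < m₀.fst`, certified against the CT report at
every seed `h ∈ (0, h₀]`. -/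
def SeededBrokenRegimeBoseFermiPinnedAt (kStar₀ etaStar₀ : ℚ) : Prop :=
  ∃ Θ : SymmetricTolerance, ∀ U ∈ Set.Icc (2:ℝ) 3, ∀ δ ∈ Set.Icc (1/5:ℝ) (7/20), ∀ μ : ℝ,
    Filter.Tendsto (fun L : ℕ => ((hubbardTorusWith 2 (L + 1) 1 U μ).groundStateFunctional totalNumber).re /
      ((L + 1 : ℕ) : ℝ) ^ 2) Filter.atTop (nhds (1 - δ)) →
    ∀ (K : TrigPolyC4v) (Λ : ℝ) (L₀ : ℕ), symmetricRegimeCertificateT U μ capRgCornerDataT Θ K Λ L₀ →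
      ∃ h₀ : ℝ, 0 < h₀ ∧ ∃ D : HubbardScaleData, (D.scale : ℝ) ≤ Λ * Real.exp (-8) / 30 ∧
        D.MeetsThresholds kStar₀ etaStar₀ ∧ 0 < D.numPatches ∧ 0 < D.meanFieldDensity.fst ∧
        ∀ h ∈ Set.Ioc (0:ℝ) h₀, ∃ L₀' : ℕ, D.IsCertifiedEnclosure (hubbardScaleReportCT U μ D h) L₀'

/-- **R at fixed thresholds (restatement option (α))**: the a-posteriori criterion at the SAME literals. -/
def AposterioriOrderCriterionRAt (kStar₀ etaStar₀ : ℚ) : Prop :=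
  ∀ (U μ h₀ : ℝ) (D : HubbardScaleData), 0 < h₀ →
    (∀ h ∈ Set.Ioc (0:ℝ) h₀, ∃ L₀ : ℕ, D.IsCertifiedEnclosure (hubbardScaleReportCT U μ D h) L₀) →
    D.MeetsThresholds kStar₀ etaStar₀ → ((D.meanFieldDensity.fst : ℚ) : ℝ) / 2 ≤ dWaveOrderParameter U μ

/-- **The certified chain closes at fixed thresholds** (pure logic, as `fixedPointOfCertifiedChain` / the route's `closes`):
`[2] → [3]At k η → RAt k η → FixedPointDWaveOrder`. -/
theorem fixedPoint_of_at (kStar₀ etaStar₀ : ℚ) (h2 : CapRgSymmetricCertificatePinned)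
    (h3 : SeededBrokenRegimeBoseFermiPinnedAt kStar₀ etaStar₀) (hR : AposterioriOrderCriterionRAt kStar₀ etaStar₀) :
    FixedPointDWaveOrder := by
  obtain ⟨Θ, h3all⟩ := h3
  obtain ⟨U, hU, δ, hδ, μ, hdens, hcert⟩ := h2
  obtain ⟨K, Λ, L₀, hc⟩ := hcert Θ
  obtain ⟨h₀, hh₀, D, -, hmeets, -, hm₀, hencl⟩ := h3all U hU δ hδ μ hdens K Λ L₀ hc
  have hle := hR U μ h₀ D hh₀ hencl hmeets
  have hm₀' : (0 : ℝ) < ((D.meanFieldDensity.fst : ℚ) : ℝ) := by exact_mod_cast hm₀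
  refine ⟨U, hU, δ, hδ, μ, hdens, ?_⟩
  rw [hasDWaveOrder_iff]
  linarith

/-- The current crux implies its fixed-threshold form WITHOUT the scale cap being derivable — recorded to make the
difference explicit: `SeededBrokenRegimeBoseFermiPinned → ∀ k η > 0, (uncapped variant of) [3]At k η`.  (The capped form is
NOT a consequence of the current statement; the cap is new content requested by drefute W1.) -/
theorem at_uncapped_of_current (h3 : SeededBrokenRegimeBoseFermiPinned) (kStar₀ etaStar₀ : ℚ) (hk : 0 < kStar₀)
    (he : 0 < etaStar₀) :
    ∃ Θ : SymmetricTolerance, ∀ U ∈ Set.Icc (2:ℝ) 3, ∀ δ ∈ Set.Icc (1/5:ℝ) (7/20), ∀ μ : ℝ,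
      Filter.Tendsto (fun L : ℕ => ((hubbardTorusWith 2 (L + 1) 1 U μ).groundStateFunctional totalNumber).re /
        ((L + 1 : ℕ) : ℝ) ^ 2) Filter.atTop (nhds (1 - δ)) →
      ∀ (K : TrigPolyC4v) (Λ : ℝ) (L₀ : ℕ), symmetricRegimeCertificateT U μ capRgCornerDataT Θ K Λ L₀ →
        ∃ h₀ : ℝ, 0 < h₀ ∧ ∃ D : HubbardScaleData,
          D.MeetsThresholds kStar₀ etaStar₀ ∧ 0 < D.numPatches ∧ 0 < D.meanFieldDensity.fst ∧
          ∀ h ∈ Set.Ioc (0:ℝ) h₀, ∃ L₀' : ℕ, D.IsCertifiedEnclosure (hubbardScaleReportCT U μ D h) L₀' :=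
  h3 kStar₀ etaStar₀ hk he

end Summit.HubbardSuperconductivity.HubbardSuperconductivity.Cruxes.SeededBrokenRegimeBoseFermiPinned.Restatement
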